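import Literature.Combinatorics.Optimization.EquivariantPsdFactorization
import HarnessLib
import HarnessLib.Audit

/-!
# Typed cell target R2 (rung leaf, D-0061): `S_n`-equivariant psd factorizations of the perfect-matching
# slack matrix have size `2^{Ω(n)}` — cell pnp-psdrank (D-0047), typed by pnp-psdrank-p2

This file ASSERTS NOTHING: it defines one statement (`def … : Prop`, tagged `@[conjecture]` = an obligation
node of our theories, NOT a published theorem) with an unfolding `example`. It is RUNG 2 of the cell's ladder
(HOME/pnp-psdrank-p2/TARGET.md v1.2, ROUND-2 §3): the matching instance of the Fawzi–Saunderson–Parrilo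
programme [cite: FawziSaundersonParrilo2013, Thm. 1 (p. 7)] — an equivariant psd factorization of size `d`
yields an `S_n`-invariant subspace of functions on perfect matchings of dimension `≤ d²` in which every
odd-cut slack is a sum of squares; low-dimensional invariant subspaces consist of low-degree functions
(the matching analogue of FSP's parity lemma, not found in print); low-degree sums of squares of the odd-cut
slacks are excluded by BBCHPRRWZ §4 + Grigoriev's MOD-2 degree bound. It strictly contains the printed
coordinate-symmetric theorem [cite: BraunEtAl2016, Thm. 4.10 (p. 10)] (permutation representations) and is
optimal in form (the facet factorization is equivariant of size `2^{n−1}`). The whole assembly over five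
provable-now lemmas + Grigoriev's named fact is kernel-checked in the cell (`equivariantAssemblyV_holds`,
Sketch-v3-imports.lean, referee PASS 2026-08-25). SYMMETRIC STRENGTH ONLY — WHAT THIS IS NOT: not a bound on
general psd rank (that target is `Summit.PneNP.MatchingPsdRank.MatchingPsdRankStretchedExp`); nothing here is
a claim on P vs NP.
-/

noncomputable section

namespace Summit.PneNP.MatchingPsdRank

open Literature.Barriers.PneNP Literature.Combinatorics.Optimization

/-- **Rung 2 (equivariant psd rank of the perfect matching polytope is `2^{Ω(n)}`).** There are `α > 0`,
`n₀` such that for every even `n ≥ n₀`, every `S_n`-equivariant psd factorization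
(`Literature.Combinatorics.Optimization.HasEquivariantPsdFactorization`: arbitrary real congruence action on
the matching-side factor, odd-set factor unconstrained) of the odd-cut slack matrix of `P_PM(n)` has size
`d ≥ 2^{α n}`. Not in print (generalises BBCHPRRWZ Thm 4.10 from coordinate-symmetric to equivariant).
[cite: FawziSaundersonParrilo2013, Thm. 1 (p. 7)] [cite: BraunEtAl2016, Thm. 4.10 (p. 10)] -/
@[conjecture]
def MatchingEquivariantPsdBound : Prop :=
  ∃ α : ℝ, 0 < α ∧ ∃ n₀ : ℕ, ∀ n : ℕ, n₀ ≤ n → Even n → ∀ d : ℕ,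
    HasEquivariantPsdFactorization n d → (2 : ℝ) ^ (α * n) ≤ d

/-- Unfolding (the statement is exactly the displayed formula). -/
example : MatchingEquivariantPsdBound ↔
    ∃ α : ℝ, 0 < α ∧ ∃ n₀ : ℕ, ∀ n : ℕ, n₀ ≤ n → Even n → ∀ d : ℕ,
      (∃ (ρ : Equiv.Perm (Fin n) →* GL (Fin d) ℝ) (A : Finset (Sym2 (Fin n)) → Matrix (Fin d) (Fin d) ℝ)
          (B : Finset (Fin n) → Matrix (Fin d) (Fin d) ℝ), IsEquivariantPsdFactorization n d ρ A B) →
        (2 : ℝ) ^ (α * n) ≤ d :=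
  Iff.rfl

end Summit.PneNP.MatchingPsdRank

end
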